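import Summits.AtomisticToContinuum.FouriersLaw.Theorems.EmbeddedDrudeMourreDrudeDissolutionStubWickShellStaticShell
import Summits.AtomisticToContinuum.FouriersLaw.Theorems.EmbeddedDrudeMourreDrudeDissolutionStubWickShellStaticTwoPoint
import HarnessLib

/-!
# Stub K2 `stub_wickShellStatic`, part IV: the pattern expansion on the zero-momentum shells
(line `gram-pencil-harmonic-chaos`, crux `EmbeddedDrudeMourre.DrudeDissolution`,
item stmt-AtomisticToContinuum-12593; `--supports` file, closes nothing; lead c11)

WHAT. The heart of the static shell formula. For Wick monomial data `f, g : Fin N → TestFn` and two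
relabellings `ρ, π` of the slots, the lattice sum over `y` of the product of shifted two-point functions
`Π_i C₁(f_{ρ i}, τ_y g_{π i})` equals a sum over CREATION PATTERNS `S ⊆ Fin N` of integrals over the big shell
`Shell N 0` (momentum conservation = lattice Parseval, taken as the hypothesis `hP`, discharged for `N = 2, 4`
from `latticeParseval`), each of which transports to the sector shell `Shell |S| |Sᶜ|` as
`∫ conj(K_{f∘ρ}) K_{g∘π} dσ` with the pattern kernels of `sum_perm_slotKernel_eq`; summing over `ρ, π`
symmetrises both kernels into `√(m!n!)·wickKernel`, so that

  `Σ_ρ Σ_π Σ_y Π_i C₁(f_{ρ i}, τ_y g_{π i}) = Σ_S |S|! |Sᶜ|! ⟪wickVector f s_S, wickVector g s_S⟫`   (`patternExpansion`).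
-/

noncomputable section

namespace Summit.AtomisticToContinuum.FouriersLaw.Theorems.DrudeDissolution.GramPencilHarmonicChaos

open MeasureTheory Filter Set Function Topology
open scoped InnerProductSpace ENNReal ComplexConjugate
open Literature.MathematicalPhysics.KineticTheory
open Literature.MathematicalPhysics.KineticTheory.HeatConduction
open HarmonicChaos ProbabilityTheory
open PinnedChainKinetic (𝕋 𝕋3 μ𝕋 μ𝕋3)
open scoped Literature.MathematicalPhysics.KineticTheory.HeatConduction.PinnedChainKinetic

/-! ## The one-phonon pair amplitude of two linear observables -/

/-- Continuity of the pair amplitude `A_{f,g} = conj(w_f)·w_g`. [folklore] -/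
theorem continuous_pairAmp {ω₂ : ℝ} (hω : 0 < ω₂) (T : ℝ) (f g : TestFn) :
    Continuous fun k : 𝕋 => conj (thermalWave ω₂ T f k) * thermalWave ω₂ T g k :=
  (Complex.continuous_conj.comp (continuous_thermalWave hω T f)).mul (continuous_thermalWave hω T g)

/-- **The shifted two-point function as a sum of two Fourier coefficients** (annihilation + creation
channel): `C_T(f, τ_y g) = Â(−y) + Â†(−y)`, `A = conj(w_f) w_g`, `A†(k) = conj(A(−k))`. [folklore] -/
theorem thermalCov_shift_eq_fourierCoeff_add {ω₂ : ℝ} (hω : 0 < ω₂) {T : ℝ} (hT : 0 ≤ T) (f g : TestFn)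
    (y : ℤ) :
    ((thermalCov ω₂ T f (Finsupp.mapDomain (fun x : ℤ => x + y) g.1,
        Finsupp.mapDomain (fun x : ℤ => x + y) g.2) : ℝ) : ℂ) =
      fourierCoeff (fun k : 𝕋 => conj (thermalWave ω₂ T f k) * thermalWave ω₂ T g k) (-y) +
        fourierCoeff (fun k : 𝕋 => conj (conj (thermalWave ω₂ T f (-k)) * thermalWave ω₂ T g (-k))) (-y) := by
  rw [thermalCov_shift_eq_two_mul_re hω hT f g y]
  set A : 𝕋 → ℂ := fun k => conj (thermalWave ω₂ T f k) * thermalWave ω₂ T g k with hA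
  set z : ℂ := ∫ k : 𝕋, fourier y k * A k ∂μ𝕋 with hz
  have h1 : fourierCoeff A (-y) = z := by
    unfold fourierCoeff
    simp only [neg_neg, smul_eq_mul]
    rfl
  have h2 : fourierCoeff (fun k : 𝕋 => conj (A (-k))) (-y) = conj z := by
    unfold fourierCoeff
    simp only [neg_neg, smul_eq_mul]
    rw [hz, ← integral_conj]
    have hsub : ∫ k : 𝕋, fourier y k * conj (A (-k)) ∂μ𝕋 =
        ∫ k : 𝕋, (fun k' => conj (fourier y k' * A k')) (-k) ∂μ𝕋 := by
      refine integral_congr_ae (ae_of_all _ fun k => ?_)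
      simp only [map_mul, fourier_apply_neg, Complex.conj_conj]
    rw [hsub]
    exact measurePreserving_neg_circle.integral_comp (MeasurableEquiv.neg 𝕋).measurableEmbedding
      (fun k' => conj (fourier y k' * A k'))
  change ((2 * z.re : ℝ) : ℂ) = fourierCoeff A (-y) + fourierCoeff (fun k : 𝕋 => conj (A (-k))) (-y)
  rw [h1, h2, Complex.add_conj]

/-! ## Parseval on the big shell (hypothesis form) -/

/-- Lattice Parseval in big-shell form for `N` factors: `Σ_y Π_x ĥ_x(y) = ∫_{Shell N 0} Π_x h_x(k_x) dσ`
(a `Prop`-valued abbreviation of the hypothesis, NOT a definition of the line: it is stated inline in every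
theorem below). For `N = 2, 4` it follows from `latticeParseval` and the torus parametrisations of the big
shells. [folklore] -/
theorem bigShellParseval_of_four
    (hP4 : ∀ h₁ h₂ h₃ h₄ : 𝕋 → ℂ, Continuous h₁ → Continuous h₂ → Continuous h₃ → Continuous h₄ →
      HasSum (fun y : ℤ => fourierCoeff h₁ y * fourierCoeff h₂ y * fourierCoeff h₃ y * fourierCoeff h₄ y)
        (∫ κ : 𝕋3, h₁ κ.1 * h₂ κ.2.1 * h₃ κ.2.2 * h₄ (-(κ.1 + κ.2.1 + κ.2.2)) ∂μ𝕋3))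
    (B : Fin 4 → 𝕋 → ℂ) (hB : ∀ x, Continuous (B x)) :
    HasSum (fun y : ℤ => ∏ x, fourierCoeff (B x) y)
      (∫ κ : Shell 4 0, ∏ x, B x ((κ : SectorConfig 4 0).1 x) ∂shellMeasure 4 0) := by
  obtain ⟨Φ, hΦ, hc⟩ := exists_bigShell_four
  have h := hP4 (B 0) (B 1) (B 2) (B 3) (hB 0) (hB 1) (hB 2) (hB 3)
  have hG : Continuous fun κ : Shell 4 0 => ∏ x, B x ((κ : SectorConfig 4 0).1 x) :=
    continuous_finsetProd _ fun x _ =>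
      (hB x).comp ((continuous_apply x).comp (continuous_fst.comp continuous_subtype_val))
  rw [← hΦ.map_eq, integral_map hΦ.measurable.aemeasurable hG.aestronglyMeasurable]
  convert h using 2
  · simp [Fin.prod_univ_four, mul_assoc]
  · funext κ
    rw [Fin.prod_univ_four, hc κ]
    simp [mul_assoc]

/-- Lattice Parseval in big-shell form for two factors. [folklore] -/
theorem bigShellParseval_of_two
    (hP2 : ∀ h₁ h₂ : 𝕋 → ℂ, Continuous h₁ → Continuous h₂ →
      HasSum (fun y : ℤ => fourierCoeff h₁ y * fourierCoeff h₂ y) (∫ k : 𝕋, h₁ k * h₂ (-k) ∂μ𝕋))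
    (B : Fin 2 → 𝕋 → ℂ) (hB : ∀ x, Continuous (B x)) :
    HasSum (fun y : ℤ => ∏ x, fourierCoeff (B x) y)
      (∫ κ : Shell 2 0, ∏ x, B x ((κ : SectorConfig 2 0).1 x) ∂shellMeasure 2 0) := by
  obtain ⟨Φ, hΦ, hc⟩ := exists_bigShell_two
  have h := hP2 (B 0) (B 1) (hB 0) (hB 1)
  have hG : Continuous fun κ : Shell 2 0 => ∏ x, B x ((κ : SectorConfig 2 0).1 x) :=
    continuous_finsetProd _ fun x _ =>
      (hB x).comp ((continuous_apply x).comp (continuous_fst.comp continuous_subtype_val))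
  rw [← hΦ.map_eq, integral_map hΦ.measurable.aemeasurable hG.aestronglyMeasurable]
  convert h using 2
  · simp [Fin.prod_univ_two]
  · funext k
    rw [Fin.prod_univ_two, hc k]
    simp

/-! ## The pattern expansion -/

/-- **One pattern, transported to its sector shell.** For a creation pattern `S ⊆ Fin N` with slot
bijection `e : Fin m ⊕ Fin n ≃ Fin N` (`e(inl ·) ∈ S`, `e(inr ·) ∉ S`), the big-shell integral of the pattern
product of pair amplitudes is the sector-shell integral of `conj(K_f)·K_g` with the pattern kernels
`K_h(κ) = Π_i conj(w_{h(e(inl i))}(κ.1 i)) · Π_j w_{h(e(inr j))}(κ.2 j)`. [folklore] -/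
theorem pattern_integral_eq {ω₂ : ℝ} (hω : 0 < ω₂) (T : ℝ) {N m n : ℕ} (f g : Fin N → TestFn)
    (S : Finset (Fin N)) (e : Fin m ⊕ Fin n ≃ Fin N) (hl : ∀ i, e (Sum.inl i) ∈ S)
    (hr : ∀ j, e (Sum.inr j) ∉ S) :
    ∫ κ : Shell N 0, ∏ x, (if x ∈ S then
        (fun k : 𝕋 => conj (conj (thermalWave ω₂ T (f x) (-k)) * thermalWave ω₂ T (g x) (-k)))
        else (fun k : 𝕋 => conj (thermalWave ω₂ T (f x) k) * thermalWave ω₂ T (g x) k))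
          ((κ : SectorConfig N 0).1 x) ∂shellMeasure N 0 =
      ∫ κ : Shell m n,
        conj ((∏ i : Fin m, conj (thermalWave ω₂ T (f (e (Sum.inl i))) ((κ : SectorConfig m n).1 i))) *
            ∏ j : Fin n, thermalWave ω₂ T (f (e (Sum.inr j))) ((κ : SectorConfig m n).2 j)) *
          ((∏ i : Fin m, conj (thermalWave ω₂ T (g (e (Sum.inl i))) ((κ : SectorConfig m n).1 i))) *
            ∏ j : Fin n, thermalWave ω₂ T (g (e (Sum.inr j))) ((κ : SectorConfig m n).2 j)) ∂shellMeasure m n := by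
  classical
  obtain ⟨Φ, hΦ, hΦc⟩ := exists_shellTransport e
  -- the right-hand integrand as a function on `Shell m n`
  set G : Shell m n → ℂ := fun κ =>
    conj ((∏ i : Fin m, conj (thermalWave ω₂ T (f (e (Sum.inl i))) ((κ : SectorConfig m n).1 i))) *
        ∏ j : Fin n, thermalWave ω₂ T (f (e (Sum.inr j))) ((κ : SectorConfig m n).2 j)) *
      ((∏ i : Fin m, conj (thermalWave ω₂ T (g (e (Sum.inl i))) ((κ : SectorConfig m n).1 i))) *
        ∏ j : Fin n, thermalWave ω₂ T (g (e (Sum.inr j))) ((κ : SectorConfig m n).2 j)) with hG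
  have hGc : Continuous G := by
    have h1 : ∀ (h : TestFn) (i : Fin m), Continuous fun κ : Shell m n =>
        thermalWave ω₂ T h ((κ : SectorConfig m n).1 i) := fun h i =>
      (continuous_thermalWave hω T h).comp ((continuous_apply i).comp (continuous_fst.comp continuous_subtype_val))
    have h2 : ∀ (h : TestFn) (j : Fin n), Continuous fun κ : Shell m n =>
        thermalWave ω₂ T h ((κ : SectorConfig m n).2 j) := fun h j =>
      (continuous_thermalWave hω T h).comp ((continuous_apply j).comp (continuous_snd.comp continuous_subtype_val))
    rw [hG]
    refine Continuous.mul (Complex.continuous_conj.comp (Continuous.mul ?_ ?_)) (Continuous.mul ?_ ?_)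
    · exact continuous_finsetProd _ fun i _ => Complex.continuous_conj.comp (h1 _ i)
    · exact continuous_finsetProd _ fun j _ => h2 _ j
    · exact continuous_finsetProd _ fun i _ => Complex.continuous_conj.comp (h1 _ i)
    · exact continuous_finsetProd _ fun j _ => h2 _ j
  change _ = ∫ κ, G κ ∂shellMeasure m n
  rw [← hΦ.map_eq, integral_map hΦ.measurable.aemeasurable hGc.aestronglyMeasurable]
  refine integral_congr_ae (ae_of_all _ fun κ => ?_)
  -- pointwise: reindex the product along `e` and split the two summands
  beta_reduce
  rw [← Fintype.prod_equiv e (fun z => (if e z ∈ S then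
        (fun k : 𝕋 => conj (conj (thermalWave ω₂ T (f (e z)) (-k)) * thermalWave ω₂ T (g (e z)) (-k)))
        else (fun k : 𝕋 => conj (thermalWave ω₂ T (f (e z)) k) * thermalWave ω₂ T (g (e z)) k))
          ((κ : SectorConfig N 0).1 (e z))) _ (fun _ => rfl), Fintype.prod_sum_type]
  simp only [hl, hr, if_true, if_false]
  obtain ⟨hc1, hc2⟩ := hΦc κ
  rw [hG]
  simp only
  have e1 : ∀ i : Fin m, (κ : SectorConfig N 0).1 (e (Sum.inl i)) = -(((Φ κ : Shell m n) : SectorConfig m n).1 i) :=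
    fun i => by rw [hc1 i, neg_neg]
  simp_rw [e1, hc2, neg_neg, map_mul, map_prod, Complex.conj_conj]
  rw [Finset.prod_mul_distrib, Finset.prod_mul_distrib]
  ring

/-- **Symmetrised sector integral.** Summing the previous right-hand side over all relabellings `ρ` of
`f`'s slots and `π` of `g`'s slots gives `m! n! ⟪wickVector f (m,n), wickVector g (m,n)⟫`. [cite: Janson1997, Thm 3.9] -/
theorem sum_sum_pattern_integral_eq_inner {ω₂ : ℝ} (hω : 0 < ω₂) (T : ℝ) {N m n : ℕ}
    (hmn : (m, n) ≠ (0, 0)) (f g : Fin N → TestFn) (e : Fin m ⊕ Fin n ≃ Fin N) :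
    ∑ ρ : Equiv.Perm (Fin N), ∑ π : Equiv.Perm (Fin N), ∫ κ : Shell m n,
        conj ((∏ i : Fin m, conj (thermalWave ω₂ T (f (ρ (e (Sum.inl i)))) ((κ : SectorConfig m n).1 i))) *
            ∏ j : Fin n, thermalWave ω₂ T (f (ρ (e (Sum.inr j)))) ((κ : SectorConfig m n).2 j)) *
          ((∏ i : Fin m, conj (thermalWave ω₂ T (g (π (e (Sum.inl i)))) ((κ : SectorConfig m n).1 i))) *
            ∏ j : Fin n, thermalWave ω₂ T (g (π (e (Sum.inr j)))) ((κ : SectorConfig m n).2 j)) ∂shellMeasure m n =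
      ((m.factorial * n.factorial : ℕ) : ℂ) *
        ⟪wickVector ω₂ T f (SectorIndex.mk m n hmn), wickVector ω₂ T g (SectorIndex.mk m n hmn)⟫_ℂ := by
  -- continuity / integrability of the pattern kernels
  have h1 : ∀ (h : TestFn) (i : Fin m), Continuous fun κ : Shell m n =>
      thermalWave ω₂ T h ((κ : SectorConfig m n).1 i) := fun h i =>
    (continuous_thermalWave hω T h).comp ((continuous_apply i).comp (continuous_fst.comp continuous_subtype_val))
  have h2 : ∀ (h : TestFn) (j : Fin n), Continuous fun κ : Shell m n =>
      thermalWave ω₂ T h ((κ : SectorConfig m n).2 j) := fun h j =>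
    (continuous_thermalWave hω T h).comp ((continuous_apply j).comp (continuous_snd.comp continuous_subtype_val))
  set K : (Fin N → TestFn) → Shell m n → ℂ := fun h κ =>
    (∏ i : Fin m, conj (thermalWave ω₂ T (h (e (Sum.inl i))) ((κ : SectorConfig m n).1 i))) *
      ∏ j : Fin n, thermalWave ω₂ T (h (e (Sum.inr j))) ((κ : SectorConfig m n).2 j) with hK
  have hKc : ∀ h, Continuous (K h) := fun h => by
    rw [hK]
    exact (continuous_finsetProd _ fun i _ => Complex.continuous_conj.comp (h1 _ i)).mul
      (continuous_finsetProd _ fun j _ => h2 _ j)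
  have hint : ∀ ρ π : Equiv.Perm (Fin N), Integrable (fun κ => conj (K (f ∘ ρ) κ) * K (g ∘ π) κ) (shellMeasure m n) :=
    fun ρ π => (memLp_two_of_continuous_shell ((Complex.continuous_conj.comp (hKc _)).mul (hKc _))).integrable one_le_two
  change ∑ ρ : Equiv.Perm (Fin N), ∑ π : Equiv.Perm (Fin N), ∫ κ, conj (K (f ∘ ρ) κ) * K (g ∘ π) κ ∂shellMeasure m n = _
  have hinner : ∀ ρ : Equiv.Perm (Fin N),
      ∑ π : Equiv.Perm (Fin N), ∫ κ, conj (K (f ∘ ρ) κ) * K (g ∘ π) κ ∂shellMeasure m n =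
        ∫ κ, ∑ π : Equiv.Perm (Fin N), conj (K (f ∘ ρ) κ) * K (g ∘ π) κ ∂shellMeasure m n :=
    fun ρ => (integral_finsetSum _ (fun π _ => hint ρ π)).symm
  rw [Finset.sum_congr rfl (fun ρ _ => hinner ρ),
    ← integral_finsetSum _ (fun ρ _ => integrable_finsetSum _ (fun π _ => hint ρ π))]
  -- symmetrise both kernels
  have hsymm : ∀ (h : Fin N → TestFn) (κ : Shell m n), ∑ ρ : Equiv.Perm (Fin N), K (h ∘ ρ) κ =
      ((Real.sqrt (m.factorial * n.factorial) : ℝ) : ℂ) * wickKernel ω₂ T h m n κ := by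
    intro h κ
    rw [hK]
    exact sum_perm_slotKernel_eq ω₂ T e h κ
  have hpt : ∀ κ : Shell m n, ∑ ρ : Equiv.Perm (Fin N), ∑ π : Equiv.Perm (Fin N), conj (K (f ∘ ρ) κ) * K (g ∘ π) κ =
      ((m.factorial * n.factorial : ℕ) : ℂ) * (conj (wickKernel ω₂ T f m n κ) * wickKernel ω₂ T g m n κ) := by
    intro κ
    rw [← Finset.sum_mul_sum, ← map_sum, hsymm f κ, hsymm g κ, map_mul, Complex.conj_ofReal]
    have hsq : ((Real.sqrt (m.factorial * n.factorial) : ℝ) : ℂ) * ((Real.sqrt (m.factorial * n.factorial) : ℝ) : ℂ) =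
        ((m.factorial * n.factorial : ℕ) : ℂ) := by
      rw [← Complex.ofReal_mul, Real.mul_self_sqrt (by positivity)]
      push_cast
      ring
    rw [← hsq]
    ring
  simp_rw [hpt]
  rw [integral_const_mul]
  congr 1
  -- the `L²` inner product of the Wick vectors on the sector `(m, n)`
  rw [MeasureTheory.L2.inner_def]
  refine integral_congr_ae ?_
  filter_upwards [coeFn_wickVector hω T f (SectorIndex.mk m n hmn), coeFn_wickVector hω T g (SectorIndex.mk m n hmn)]
    with κ hf hg
  rw [RCLike.inner_apply', hf, hg]
  rfl

end Summit.AtomisticToContinuum.FouriersLaw.Theorems.DrudeDissolution.GramPencilHarmonicChaos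

end
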